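import Summits.AnomalousDissipation.AnomalousDissipation.Theorems.WindLineWindyGalerkinSteadyZerothLawGenericLeafNondegeneracyToolsL
import Summits.AnomalousDissipation.AnomalousDissipation.Theorems.WindLineWindyGalerkinSteadyZerothLawGenericLeafNondegeneracyToolsJ
import Summits.AnomalousDissipation.AnomalousDissipation.Theorems.WindLineWindyGalerkinSteadyZerothLawGenericLeafNondegeneracyToolsK

/-!
# Generic leaf-nondegeneracy (stub B of crux `WindLine.WindyGalerkinSteadyZerothLaw`,
# stmt-AnomalousDissipation-11414): the nondegenerate parameters are DENSE

The DENSITY HALF of stub B (pure proof file, no definitions): for `ν > 0` and a momentum `m`, the set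
of admissible parameters `c ∈ 𝒜` all of whose classical steady states of `NS_ν(F⟦c⟧)` with
`∫ u = m` are leaf-nondegenerate is dense in `𝒜` (`dense_leafNondegenerate`, registered sub-goal
`genericLeaf_dense`).  This is Foias–Temam's generic regularity of the steady solution set
(LNM 565 (1976) Thm. 1 and the finite-mode Sard argument of p. 26; CPAM 30 (1977); Ann. SNS Pisa 5
(1978) Thm. 3.1–3.2), run at fixed momentum in the leaf and pulled back to `𝒜`:

fix `c₀ ∈ 𝒜` and `ε > 0`; on the lattice the steady states of `NS_ν(F⟦c⟧)` with momentum `m` are the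
solutions of `G(x) = Y c`, `G(x) = 4π²ν x + D x + B(x,x)` (tools C).  The solution set at `c₀` is
compact (tools H), each solution has `T(x) = DG(x) = 4π²ν + compact` of index zero (tools E, F), so
finitely many Fourier modes are transversal to `G` uniformly on a neighbourhood `U` of it (tools G, I),
and all solutions for `‖c − c₀‖ < r` lie in `U` (tools H).  Along the finite-mode slice
`c₀ + Γ_N ⊆ 𝒜` (tools L) the parametrised map `Ψ(x, γ) = G(x) − Y c₀ − F_N γ` is therefore a
submersion near its small-parameter zeros, with kernels of the dimension of `Γ_N` (tools J); the
finite-dimensional Smale–Sard step (tools K) yields `γ` with `‖γ‖ < min(r, ε)` all of whose zeros have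
`T(x)` onto, hence injective (tools E), hence — by the dictionary of tools C — every classical steady
state of `NS_ν(F⟦c₀ + γ⟧)` with `∫ u = m` is leaf-nondegenerate.

References: FoiasTemam1976 (LNM 565, pp. 24–28), FoiasTemam1977 (CPAM 30, 149–164), FoiasTemam1978
(Ann. SNS Pisa (4) 5, Thm. 3.1–3.2), SautTemam1979 (Comm. PDE 4, §2), Smale1965 (Amer. J. Math. 87).
-/

noncomputable section

-- D-0017: single-problem summit ⇒ the duplicated namespace segment is by design.
set_option linter.dupNamespace false

open scoped BigOperators Topology ENNReal NNReal InnerProductSpace ComplexConjugate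
open Filter Set Function TopologicalSpace MeasureTheory UnitAddTorus
open Literature.Analysis.FunctionSpaces Literature.Analysis.FunctionSpaces.Torus
open Literature.Analysis.FunctionSpaces.EuclideanSpace
open Literature.Analysis.FluidPDE Literature.Analysis.FluidPDE.Torus
open Literature.Analysis.FluidPDE.ScalarFourier
open Literature.Analysis.FluidPDE.SteadyLattice Literature.Analysis.FluidPDE.SteadyLatticeDrift

namespace Summit.AnomalousDissipation.AnomalousDissipation.Theorems.WindLineWindyGalerkinSteadyZerothLaw.GenericLeaf

/-- The flat three-torus (local notation). -/
local notation "𝕋³" => UnitAddTorus (Fin 3)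
/-- Velocity values (local notation). -/
local notation "E³" => EuclideanSpace ℝ (Fin 3)
/-- Complex coefficient vectors (local notation). -/
local notation "ℂ³" => EuclideanSpace ℂ (Fin 3)
/-- Square-summable coefficient families `ℤ³ → ℂ³` (local notation). -/
local notation "ℓ2" => lp (fun _ : Fin 3 → ℤ => EuclideanSpace ℂ (Fin 3)) 2
/-- Physical coefficients `x̌(k) = x(k)/|k|²` of a family (local notation, the tree's `cf`). -/
local notation "cf[" X "]" =>
  ((fun mm : Fin 3 → ℤ => (((freqNormSq mm)⁻¹ : ℝ) : ℂ)) • (X : (Fin 3 → ℤ) → EuclideanSpace ℂ (Fin 3)))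
/-- `k · v = ∑ⱼ kⱼ vⱼ` (local notation, the tree's `kdot`). -/
local notation "kdot[" k "," v "]" =>
  (∑ jj : Fin 3, (((k : Fin 3 → ℤ) jj : ℤ) : ℂ) * (v : EuclideanSpace ℂ (Fin 3)) jj)
/-- The convective symbol `N(a, b)(k)` as a vector of `ℂ³` (local notation, the tree's `nl`). -/
local notation "nl[" a "," b "," k "]" =>
  ((WithLp.toLp 2 (fun pp : Fin 3 => transportSym (fun jj mm => (a : (Fin 3 → ℤ) → EuclideanSpace ℂ (Fin 3)) mm jj)
    (fun mm => (b : (Fin 3 → ℤ) → EuclideanSpace ℂ (Fin 3)) mm pp) k)) : EuclideanSpace ℂ (Fin 3))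
set_option quotPrecheck false in
/-- admissible parameters -/
local notation "𝒜" => ({c : SymL2 (Fin 3) | c 0 = 0 ∧
  ∀ k : Fin 3 → ℤ, ∑ j : Fin 3, ((k j : ℤ) : ℂ) * c k j = 0} : Set (SymL2 (Fin 3)))
/-- the force of a parameter -/
local notation "F⟦" c "⟧" => SymL2.field (fun k : Fin 3 → ℤ => Real.exp (freqNormSq k)) (c : SymL2 (Fin 3))

/-! ## The density theorem -/

-- the operator-norm instances on `W × Γ →L[ℝ] W` (`W` a subtype of `ℓ²`) are expensive to synthesise
set_option synthInstance.maxHeartbeats 160000 in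
set_option maxHeartbeats 1600000 in
/-- **The nondegenerate parameters are dense** (density half of stub B; Foias–Temam's generic
regularity of the steady solution set at fixed momentum, pulled back to `𝒜`).  See the module
docstring for the proof. [folklore] -/
theorem dense_leafNondegenerate (ν : ℝ) (m : E³) (hν : 0 < ν) :
    Dense {c : 𝒜 | ∀ (u : 𝕋³ → E³) (p : 𝕋³ → ℝ),
      IsSteadyNSState ν F⟦c⟧ u p → ∫ x, u x = m → ¬ IsLinNSEigenvalue ν u 0} := by
  refine Metric.dense_iff.2 fun c₀ ε hε => ?_
  -- §1 lattice set-up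
  obtain ⟨W, hW, hWc⟩ := exists_space
  haveI : CompleteSpace W := completeSpace_W hWc
  haveI : SeparableSpace ℓ2 := SqFam.separableSpace (d := Fin 3)
  obtain ⟨B, hB, hBb⟩ := exists_bilinear hW
  obtain ⟨D, hD, hDc⟩ := exists_drift hW hWc (conjVec_complexify m)
  obtain ⟨Y, hY, -, hYlip⟩ := exists_forceVecMap hW
  obtain ⟨P, hP, -, -, hPlim⟩ := stub_truncationOnW W hW hWc
  have hcν : (4 * Real.pi ^ 2 * ν) ≠ 0 := by positivity
  -- §2 the solution set at `c₀`: compact, rapidly decaying; uniform stage; localisation radius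
  have hrap : ∀ (c : 𝒜) (x : W), (4 * Real.pi ^ 2 * ν) • x + D x + B x x = Y c →
      RapidDecay cf[((x : ℓ2) : (Fin 3 → ℤ) → ℂ³)] := by
    intro c x heq
    obtain ⟨u, p, -, hu, -, -, hcf⟩ := exists_steady_of_solution hW B hB D hD Y hY hν c x heq
    rw [hcf]
    exact rapidDecay_update hu.complexify_comp.rapidDecay_mFourierCoeff
  obtain ⟨N, U, hUo, hSU, hsurjU⟩ := exists_uniform_stage hWc B hB hBb D hDc P hP hPlim hcν
    {x : W | (4 * Real.pi ^ 2 * ν) • x + D x + B x x = Y c₀}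
    (isCompact_solutionSet hW hWc B hB hBb D hD Y hY hYlip hν c₀) (fun x hx => hrap c₀ x hx)
  obtain ⟨r, hr, hrU⟩ := exists_radius_solutions_subset hW hWc B hB hBb D hD Y hY hYlip hν c₀ hUo hSU
  -- §3 the finite-mode slice and the parametrised map
  obtain ⟨Γs, hΓs, hΓfd, hadm⟩ := exists_paramSlice N
  haveI := hΓfd
  obtain ⟨F, -, hFinj, hYF, hFrange⟩ := exists_sliceMap hW P hP Y hY N Γs hΓs hadm
  obtain ⟨T, hT⟩ : ∃ T : W → (W →L[ℝ] W), T = fun x => (4 * Real.pi ^ 2 * ν) • ContinuousLinearMap.id ℝ W +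
      (D + (hBb.deriv (x, x)).comp ((ContinuousLinearMap.id ℝ W).prod (ContinuousLinearMap.id ℝ W))) := ⟨_, rfl⟩
  have hTx : ∀ x, T x = (4 * Real.pi ^ 2 * ν) • ContinuousLinearMap.id ℝ W +
      (D + (hBb.deriv (x, x)).comp ((ContinuousLinearMap.id ℝ W).prod (ContinuousLinearMap.id ℝ W))) :=
    fun x => by rw [hT]
  have hTw : ∀ x w, T x w = (4 * Real.pi ^ 2 * ν) • w +
      (D + (hBb.deriv (x, x)).comp ((ContinuousLinearMap.id ℝ W).prod (ContinuousLinearMap.id ℝ W))) w :=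
    fun x w => by rw [hTx]; exact linearisation_eq B hBb D _ x w
  obtain ⟨Ψ, hΨ⟩ : ∃ Ψ : W × Γs → W, Ψ = fun z => (4 * Real.pi ^ 2 * ν) • z.1 + D z.1 + B z.1 z.1 - Y c₀ - F z.2 :=
    ⟨_, rfl⟩
  obtain ⟨Ψ', hΨ'⟩ : ∃ Ψ' : W × Γs → (W × Γs →L[ℝ] W),
      Ψ' = fun z => (T z.1).comp (ContinuousLinearMap.fst ℝ W Γs) - F.comp (ContinuousLinearMap.snd ℝ W Γs) := ⟨_, rfl⟩
  have hΨz : ∀ z, Ψ z = (4 * Real.pi ^ 2 * ν) • z.1 + D z.1 + B z.1 z.1 - Y c₀ - F z.2 := fun z => by rw [hΨ]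
  have hΨd : ∀ z, HasStrictFDerivAt Ψ (Ψ' z) z := fun z => by
    rw [hΨ, hΨ']
    dsimp only
    rw [hTx]
    exact hasStrictFDerivAt_param B hBb D F (Y c₀) _ z
  have hΨ'c : Continuous Ψ' := by rw [hΨ', hT]; exact continuous_paramDeriv B hBb D F _
  have hΨ'ap : ∀ z ζ, Ψ' z ζ = T z.1 ζ.1 - F ζ.2 := fun z ζ => by rw [hΨ']; rfl
  -- §4 transversality on `U × Γ`
  have hsurjO : ∀ z ∈ U ×ˢ (univ : Set Γs), Function.Surjective (Ψ' z) := by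
    rintro ⟨x, γ⟩ ⟨hxU, -⟩ y
    obtain ⟨ξ, η, hξη⟩ := hsurjU x hxU y
    have hmem : P N η ∈ LinearMap.range (F : Γs →ₗ[ℝ] W) := by rw [hFrange]; exact ⟨η, rfl⟩
    obtain ⟨γ', hγ'⟩ := hmem
    refine ⟨(ξ, -γ'), ?_⟩
    rw [hΨ'ap, map_neg, sub_neg_eq_add]
    change T x ξ + F γ' = y
    rw [hTx]
    exact (congrArg (fun v => _ + v) hγ').trans hξη
  -- §5 the small-parameter zero set, its localisation and index data
  have hsol : ∀ z : W × Γs, Ψ z = 0 → (4 * Real.pi ^ 2 * ν) • z.1 + D z.1 + B z.1 z.1 =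
      Y ⟨(c₀ : SymL2 (Fin 3)) + z.2, hadm c₀ z.2 z.2.2⟩ := fun z hz => by
    rw [hYF, ← sub_eq_zero, ← hz, hΨz]; abel
  have hZO : {z : W × Γs | ‖z.2‖ < r ∧ Ψ z = 0} ⊆ U ×ˢ (univ : Set Γs) := fun z hz =>
    ⟨hrU ⟨(c₀ : SymL2 (Fin 3)) + z.2, hadm c₀ z.2 z.2.2⟩ (by simpa using hz.1) z.1 (hsol z hz.2), trivial⟩
  have hidx : ∀ z ∈ {z : W × Γs | ‖z.2‖ < r ∧ Ψ z = 0},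
      FiniteDimensional ℝ (LinearMap.ker (Ψ' z : (W × Γs) →ₗ[ℝ] W)) ∧
      Module.finrank ℝ (LinearMap.ker (Ψ' z : (W × Γs) →ₗ[ℝ] W)) = Module.finrank ℝ Γs := by
    intro z hz
    have hC := isCompactOperator_drift_add_linOp hWc B hB hBb D hDc z.1 (hrap _ z.1 (hsol z hz.2))
    obtain ⟨hkfd, -, C', hC'fd, hC'c, hC'dim⟩ := exists_isCompl_range_finrank_eq hC hcν (hTw z.1)
    haveI := hkfd
    haveI := hC'fd
    have hsup : LinearMap.range (T z.1 : W →ₗ[ℝ] W) ⊔ LinearMap.range (F : Γs →ₗ[ℝ] W) = ⊤ := by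
      rw [eq_top_iff]
      rintro y -
      obtain ⟨⟨ξ, η⟩, h⟩ := hsurjO z (hZO hz) y
      rw [hΨ'ap] at h
      rw [← h]
      exact Submodule.sub_mem _ (Submodule.mem_sup_left ⟨ξ, rfl⟩) (Submodule.mem_sup_right ⟨η, rfl⟩)
    have hJ := finrank_ker_coprod_eq (T z.1 : W →ₗ[ℝ] W) (F : Γs →ₗ[ℝ] W) hFinj C' hC'c hC'dim hsup
    have e : (Ψ' z : (W × Γs) →ₗ[ℝ] W) = (T z.1 : W →ₗ[ℝ] W).coprod (-(F : Γs →ₗ[ℝ] W)) :=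
      LinearMap.ext fun ζ => by
        rw [LinearMap.coprod_apply, LinearMap.neg_apply, ← sub_eq_add_neg]
        exact hΨ'ap z ζ
    rw [e]
    exact hJ
  -- §6 Smale–Sard: a small regular slice parameter
  obtain ⟨γ, hγε, hreg⟩ := exists_small_regular_parameter Ψ Ψ' hΨd hΨ'c T F hΨ'ap (U ×ˢ (univ : Set Γs))
    (hUo.prod isOpen_univ) hsurjO {z : W × Γs | ‖z.2‖ < r ∧ Ψ z = 0} hZO (fun z hz => (hidx z hz).1)
    (fun z hz => (hidx z hz).2) (lt_min hr hε)
  -- §7 the good parameter `c₀ + γ`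
  refine ⟨⟨(c₀ : SymL2 (Fin 3)) + γ, hadm c₀ γ γ.2⟩, ?_, ?_⟩
  · rw [Metric.mem_ball, Subtype.dist_eq, dist_eq_norm]
    change ‖((c₀ : SymL2 (Fin 3)) + γ) - c₀‖ < ε
    rw [add_sub_cancel_left]
    exact lt_of_lt_of_le hγε (min_le_right _ _)
  · intro u p hst hmean hev
    have hu : IsSmooth u := steady_isSmooth hst
    obtain ⟨x, hx, hcfx⟩ := exists_stateVec hW hu (steady_isDivFree hst)
    have hM : mFourierCoeff (complexify ∘ u) 0 = complexify m := by rw [mFourierCoeff_complexify_zero hu, hmean]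
    have heq := steadyMap_stateVec_eq B hB D hD hst hM x hx (Y _) (hY _)
    have hz : ((x, γ) : W × Γs) ∈ {z : W × Γs | ‖z.2‖ < r ∧ Ψ z = 0} := by
      refine ⟨lt_of_lt_of_le hγε (min_le_left _ _), ?_⟩
      rw [hΨz]
      change (4 * Real.pi ^ 2 * ν) • x + D x + B x x - Y c₀ - F γ = 0
      rw [heq, hYF, add_sub_cancel_left, sub_self]
    have hTs : Function.Surjective (T x) := hreg x hz hz.2
    have hxr : RapidDecay cf[((x : ℓ2) : (Fin 3 → ℤ) → ℂ³)] := by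
      rw [hcfx]; exact rapidDecay_update hu.complexify_comp.rapidDecay_mFourierCoeff
    have hTi : Function.Injective (T x) :=
      injective_of_surjective (isCompactOperator_drift_add_linOp hWc B hB hBb D hDc x hxr) hcν (hTw x) hTs
    have hD' : ∀ w : W, (((D w : W) : ℓ2) : (Fin 3 → ℤ) → ℂ³) = fun k =>
        (2 * Real.pi * Complex.I * kdot[k, mFourierCoeff (complexify ∘ u) 0]) • cf[((w : ℓ2) : (Fin 3 → ℤ) → ℂ³)] k :=
      fun w => by rw [hM]; exact hD w
    obtain ⟨w, hw0, hw⟩ := exists_kernel_of_isLinNSEigenvalue hW B hB D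
      ((hBb.deriv (x, x)).comp ((ContinuousLinearMap.id ℝ W).prod (ContinuousLinearMap.id ℝ W))) x hu hD'
      (linOp_apply B hBb x) hcfx hev
    refine hw0 (hTi ?_)
    rw [hTw, hw, map_zero]

/-! ## Registered sub-goal -/

/-- **Registered sub-goal `genericLeaf_dense` — the DENSITY HALF of stub B** (worker B of
`stub_genericLeafNondegeneracy`): for `ν > 0` and every momentum `m`, the admissible parameters all of
whose classical steady states of momentum `m` are leaf-nondegenerate are dense in `𝒜`. [folklore] -/
theorem genericLeaf_dense : ∀ (ν : ℝ) (m : E³), 0 < ν → Dense {c : 𝒜 | ∀ (u : 𝕋³ → E³) (p : 𝕋³ → ℝ), IsSteadyNSState ν F⟦c⟧ u p → ∫ x, u x = m → ¬ IsLinNSEigenvalue ν u 0} :=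
  dense_leafNondegenerate

end Summit.AnomalousDissipation.AnomalousDissipation.Theorems.WindLineWindyGalerkinSteadyZerothLaw.GenericLeaf

end
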